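import Literature.AlgebraicGeometry.Motives.ProjectiveSpaceLinearSubspaces
import Literature.AlgebraicGeometry.Motives.LinesGenerateChowOne
import Literature.AlgebraicGeometry.Motives.SubschemeCyclesFundamentalProofs
import HarnessLib

/-!
# Lines in `ℙᴺ_k` as points of the scheme; the line points of an embedded scheme

Continuation of `Motives/ProjectiveSpaceLinearSubspaces`. For `t ≤ N` linearly independent
linear forms `L₁, …, L_t` on `ℙᴺ_k` (any field `k`):

* `linearSubspacePoint L` — **the generic point `ℓ_L` of `V₊(L₁, …, L_t)`**: homogeneous prime
  `(L₁, …, L_t)` (`toIdeal_linearSubspacePoint`), `closure {ℓ_L} = V₊(L)`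
  (`closure_linearSubspacePoint`, so `V₊(L)` is irreducible), `height ℓ_L = N - t`,
  `coheight ℓ_L = t`, uniqueness (`eq_linearSubspacePoint_of_closure_eq`), and every other point
  of `V₊(L)` has height `< N - t` (`height_lt_of_mem_zeroLocus`). Hartshorne I Ex. 2.11.
* **Lines** (`N ≥ 1`, `t = N - 1`): `height ℓ_L = 1` (`height_linearSubspacePoint_of_line`) and
  the other points of the line are closed points (`height_eq_zero_of_mem_line`).
* **Line points of an embedded scheme** `i : X ↪ ℙᴺ_k` (closed immersion), for the rendering
  `IsLinePoint N i z` of `Motives/LinesGenerateChowOne` ("`dim closure {z} = 1` and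
  `i(closure {z}) = V₊(L)` for `N - 1` independent linear forms"):
  the height condition is automatic (`isLinePoint_iff_exists_image_eq`), the image of a line
  point is the generic point of its line (`IsLinePoint.base_eq_linearSubspacePoint`), every line
  of `ℙᴺ` contained in `i(X)` is the image of a unique line point of `X`
  (`exists_isLinePoint_of_zeroLocus_subset`, `eq_of_image_closure_eq`). This is the dictionary
  between "lines on `X`" as used by Tian–Zong, *One-cycles on rationally connected varieties*
  (Compositio Math. 150 (2014)), Thm. 1.7, vendored as
  `TianZong2014_chowOne_generatedByLines`, and lines of the ambient projective space; it also
  certifies that the rendering `IsLinePoint` is inhabited exactly by the lines.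

Everything is proved; no named facts. What is NOT here: the scheme structure `V₊(L) ≅ ℙ¹`, the
Fano scheme (`Motives/FanoSchemeOfLines`) and its comparison with line points (its field-valued
points are lines `ℙ(W)`; the bridge is `exists_isLinePoint_of_zeroLocus_subset` once
`V₊(W^⊥) ⊆ i(X)` is known).

## References

* [Hartshorne1977] R. Hartshorne, *Algebraic Geometry*, GTM 52 (1977): I Ex. 2.11, I Prop. 1.10,
  II Prop. 2.5.
* [TianZong2014] Z. Tian, H. R. Zong, *One-cycles on rationally connected varieties*,
  Compositio Math. 150 (2014) 396–408, Thm. 1.7 (the consumer of `IsLinePoint`).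
-/

noncomputable section

open CategoryTheory AlgebraicGeometry Order

universe u

namespace Literature.AlgebraicGeometry.Motives

/-! ### The generic point `ℓ_L` of `V₊(L₁, …, L_t)`; lines -/

section LinearSubspacePoint

open _root_.MvPolynomial

variable {k : Type u} [Field k] {N : ℕ}

attribute [local instance] MvPolynomial.gradedAlgebra

local notation "𝓐" => MvPolynomial.homogeneousSubmodule (Fin (N + 1)) k

variable {t : ℕ} (L : Fin t → MvPolynomial (Fin (N + 1)) k) (hL : LinearIndependent k L)
  (hhom : ∀ j, (L j).IsHomogeneous 1) (ht : t ≤ N)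

/-- **The generic point `ℓ_L` of the linear subspace `V₊(L₁, …, L_t) ⊆ ℙᴺ_k`** cut out by
`t ≤ N` linearly independent linear forms: the point of the scheme `ℙᴺ_k` whose relevant
homogeneous prime is `(L₁, …, L_t)` (`exists_point_of_linearIndependent`; Hartshorne I Ex. 2.11,
linear varieties). For `t = N - 1` this is (the generic point of) the LINE `V₊(L)`.
[cite: Hartshorne1977, I Ex. 2.11] -/
def linearSubspacePoint : ↥(projectiveSpace N k).left :=
  (exists_point_of_linearIndependent L hL hhom ht).choose

/-- The homogeneous prime of `ℓ_L` is `(L₁, …, L_t)`. [cite: Hartshorne1977, I Ex. 2.11] -/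
theorem toIdeal_linearSubspacePoint :
    (ProjectiveSpectrum.asHomogeneousIdeal (𝒜 := 𝓐) (linearSubspacePoint L hL hhom ht)).toIdeal =
      Ideal.span (Set.range L) :=
  (exists_point_of_linearIndependent L hL hhom ht).choose_spec.1

/-- **`dim V₊(L₁, …, L_t) = N - t`**: the generic point of the linear subspace cut out by `t`
independent linear forms has height `N - t` in the specialisation order of `ℙᴺ_k`.
[cite: Hartshorne1977, I Ex. 2.11] -/
theorem height_linearSubspacePoint :
    height (linearSubspacePoint L hL hhom ht) = ((N - t : ℕ) : ℕ∞) :=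
  (exists_point_of_linearIndependent L hL hhom ht).choose_spec.2.1

/-- **`codim V₊(L₁, …, L_t) = t`**: the generic point has coheight `t`.
[cite: Hartshorne1977, I Ex. 2.11] -/
theorem coheight_linearSubspacePoint :
    coheight (linearSubspacePoint L hL hhom ht) = (t : ℕ∞) :=
  (exists_point_of_linearIndependent L hL hhom ht).choose_spec.2.2

/-- **`V₊(L₁, …, L_t)` is the closure of its generic point** (in particular it is irreducible).
[cite: Hartshorne1977, I Ex. 2.11 and II Prop. 2.5] -/
theorem closure_linearSubspacePoint :
    closure {linearSubspacePoint L hL hhom ht} =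
      ProjectiveSpectrum.zeroLocus 𝓐 (Set.range L) := by
  rw [closure_singleton_eq_zeroLocus]
  change ProjectiveSpectrum.zeroLocus 𝓐 ((ProjectiveSpectrum.asHomogeneousIdeal (𝒜 := 𝓐)
    (linearSubspacePoint L hL hhom ht)).toIdeal : Set (MvPolynomial (Fin (N + 1)) k)) = _
  rw [toIdeal_linearSubspacePoint, ProjectiveSpectrum.zeroLocus_span]

/-- The generic point lies on `V₊(L)`. [folklore] -/
theorem linearSubspacePoint_mem_zeroLocus :
    linearSubspacePoint L hL hhom ht ∈ ProjectiveSpectrum.zeroLocus 𝓐 (Set.range L) := by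
  rw [← closure_linearSubspacePoint L hL hhom ht]
  exact subset_closure rfl

/-- **Uniqueness of the generic point**: a point of `ℙᴺ_k` whose closure is `V₊(L)` is `ℓ_L`.
[folklore] -/
theorem eq_linearSubspacePoint_of_closure_eq {z : ↥(projectiveSpace N k).left}
    (hz : closure {z} = ProjectiveSpectrum.zeroLocus 𝓐 (Set.range L)) :
    z = linearSubspacePoint L hL hhom ht :=
  eq_of_closure_singleton_eq (hz.trans (closure_linearSubspacePoint L hL hhom ht).symm)

/-- **The other points of `V₊(L)` are smaller**: a point of `V₊(L₁, …, L_t)` other than its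
generic point has dimension `< N - t`. [cite: Hartshorne1977, I Ex. 2.11 with I Prop. 1.10] -/
theorem height_lt_of_mem_zeroLocus {z : ↥(projectiveSpace N k).left}
    (hz : z ∈ ProjectiveSpectrum.zeroLocus 𝓐 (Set.range L))
    (hne : z ≠ linearSubspacePoint L hL hhom ht) : height z < ((N - t : ℕ) : ℕ∞) := by
  have hle : z ≤ linearSubspacePoint L hL hhom ht := by
    rw [Scheme.le_iff_specializes, specializes_iff_mem_closure, closure_linearSubspacePoint]
    exact hz
  have hlt : z < linearSubspacePoint L hL hhom ht := lt_iff_le_not_ge.mpr ⟨hle, fun hge ↦ hne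
    ((Scheme.le_iff_specializes.mp hge).antisymm (Scheme.le_iff_specializes.mp hle)).eq⟩
  have h := height_add_one_le hlt
  rw [height_linearSubspacePoint] at h
  have hfin : height z ≠ ⊤ := by
    intro htop
    rw [htop, top_add] at h
    exact absurd h (by simp)
  exact (ENat.add_one_le_iff hfin).mp h

/-- **Lines have dimension one**: for `N ≥ 1` and `N - 1` independent linear forms the generic
point of the line `V₊(L)` has height `1`. [cite: Hartshorne1977, I Ex. 2.11] -/
theorem height_linearSubspacePoint_of_line (hN : 1 ≤ N)
    (L : Fin (N - 1) → MvPolynomial (Fin (N + 1)) k) (hL : LinearIndependent k L)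
    (hhom : ∀ j, (L j).IsHomogeneous 1) :
    height (linearSubspacePoint L hL hhom (Nat.sub_le N 1)) = 1 := by
  rw [height_linearSubspacePoint, show N - (N - 1) = 1 by omega, Nat.cast_one]

/-- The points of a line other than its generic point are closed points (height `0`).
[cite: Hartshorne1977, I Ex. 2.11] -/
theorem height_eq_zero_of_mem_line (hN : 1 ≤ N)
    (L : Fin (N - 1) → MvPolynomial (Fin (N + 1)) k) (hL : LinearIndependent k L)
    (hhom : ∀ j, (L j).IsHomogeneous 1) {z : ↥(projectiveSpace N k).left}
    (hz : z ∈ ProjectiveSpectrum.zeroLocus 𝓐 (Set.range L))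
    (hne : z ≠ linearSubspacePoint L hL hhom (Nat.sub_le N 1)) : height z = 0 := by
  have h := height_lt_of_mem_zeroLocus L hL hhom (Nat.sub_le N 1) hz hne
  rw [show N - (N - 1) = 1 by omega, Nat.cast_one] at h
  exact Order.lt_one_iff.mp h

end LinearSubspacePoint

/-! ### Lines of an embedded scheme `i : X ↪ ℙᴺ_k` -/

section EmbeddedLines

open _root_.MvPolynomial

variable {k : Type u} [Field k] {N : ℕ}

attribute [local instance] MvPolynomial.gradedAlgebra

local notation "𝓐" => MvPolynomial.homogeneousSubmodule (Fin (N + 1)) k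

variable {X : SchemeOver k} (i : X ⟶ projectiveSpace N k) [IsClosedImmersion i.left]

/-- A closed immersion maps the closure of a point onto the closure of its image. [folklore] -/
theorem image_closure_singleton (z : ↥X.left) :
    ⇑i.left.base '' closure {z} = closure {i.left.base z} := by
  rw [← i.left.isClosedEmbedding.closure_image_eq, Set.image_singleton]

/-- **Line points without the height condition.** For a closed immersion `i : X ↪ ℙᴺ_k`
(`N ≥ 1`), a point `z` of `X` is a line of `X` (`IsLinePoint N i z`) iff the image of its closure
is a line `V₊(L₁, …, L_{N-1})` of `ℙᴺ`: the condition `dim closure {z} = 1` is then automatic,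
because `i z` is the generic point of that line (`height_linearSubspacePoint_of_line`) and closed
immersions preserve heights. [cite: Hartshorne1977, I Ex. 2.11] -/
theorem isLinePoint_iff_exists_image_eq (hN : 1 ≤ N) (z : ↥X.left) :
    IsLinePoint N i z ↔ ∃ L : Fin (N - 1) → MvPolynomial (Fin (N + 1)) k, LinearIndependent k L ∧
      (∀ j, (L j).IsHomogeneous 1) ∧
        ⇑i.left.base '' closure {z} = ProjectiveSpectrum.zeroLocus 𝓐 (Set.range L) := by
  constructor
  · exact fun h ↦ h.2
  · rintro ⟨L, hL, hhom, himg⟩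
    refine ⟨?_, L, hL, hhom, himg⟩
    have hiz : i.left.base z = linearSubspacePoint L hL hhom (Nat.sub_le N 1) := by
      apply eq_linearSubspacePoint_of_closure_eq
      rw [← image_closure_singleton i z]
      exact himg
    rw [← height_base_eq_of_isClosedImmersion' i.left z, hiz,
      height_linearSubspacePoint_of_line hN]

/-- The image of a line point is the generic point of its line. [folklore] -/
theorem IsLinePoint.base_eq_linearSubspacePoint {z : ↥X.left}
    {L : Fin (N - 1) → MvPolynomial (Fin (N + 1)) k} (hL : LinearIndependent k L)
    (hhom : ∀ j, (L j).IsHomogeneous 1)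
    (himg : ⇑i.left.base '' closure {z} = ProjectiveSpectrum.zeroLocus 𝓐 (Set.range L)) :
    i.left.base z = linearSubspacePoint L hL hhom (Nat.sub_le N 1) := by
  apply eq_linearSubspacePoint_of_closure_eq
  rw [← image_closure_singleton i z]
  exact himg

/-- **Lines of `ℙᴺ` lying on `X` are lines of `X`.** If the line `V₊(L₁, …, L_{N-1})` of `ℙᴺ_k`
is contained in the image of the closed immersion `i : X ↪ ℙᴺ_k`, then it is the image of the
closure of a (unique) line point of `X`. [cite: Hartshorne1977, I Ex. 2.11] -/
theorem exists_isLinePoint_of_zeroLocus_subset (hN : 1 ≤ N)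
    (L : Fin (N - 1) → MvPolynomial (Fin (N + 1)) k) (hL : LinearIndependent k L)
    (hhom : ∀ j, (L j).IsHomogeneous 1)
    (hsub : ProjectiveSpectrum.zeroLocus 𝓐 (Set.range L) ⊆ Set.range i.left.base) :
    ∃ z : ↥X.left, IsLinePoint N i z ∧
      ⇑i.left.base '' closure {z} = ProjectiveSpectrum.zeroLocus 𝓐 (Set.range L) := by
  obtain ⟨z, hz⟩ := hsub (linearSubspacePoint_mem_zeroLocus L hL hhom (Nat.sub_le N 1))
  have himg : ⇑i.left.base '' closure {z} = ProjectiveSpectrum.zeroLocus 𝓐 (Set.range L) := by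
    rw [image_closure_singleton, hz, closure_linearSubspacePoint]
  exact ⟨z, (isLinePoint_iff_exists_image_eq i hN z).mpr ⟨L, hL, hhom, himg⟩, himg⟩

/-- A point of `X` is determined by the image of its closure under the closed immersion `i`.
[folklore] -/
theorem eq_of_image_closure_eq {z z' : ↥X.left}
    (h : ⇑i.left.base '' closure {z} = ⇑i.left.base '' closure {z'}) : z = z' := by
  rw [image_closure_singleton, image_closure_singleton] at h
  exact i.left.isClosedEmbedding.injective (eq_of_closure_singleton_eq h)

end EmbeddedLines

end Literature.AlgebraicGeometry.Motives

end
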